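import Literature.Analysis.FluidPDE.CKNTheoremB
import Literature.Analysis.FluidPDE.SuitableWeakRescaling
import Literature.Analysis.FluidPDE.CKNScalingExtras
import HarnessLib

/-!
# Caffarelli–Kohn–Nirenberg 1982, Theorem B for every viscosity
# (`ckn_epsilon_regularity → ckn_partial_regularity`)

Analysis/FluidPDE file in the decomposition of the named fact
`Literature.Analysis.FluidPDE.ckn_partial_regularity` (`PartialRegularity.lean`, ns.S11:
Caffarelli–Kohn–Nirenberg 1982, Theorem B for suitable weak solutions with viscosity `ν > 0`),
the first conjunct of the barrier fact
`Literature.Barriers.NavierStokesRegularity.SingularSetDimensionBound`. The companion file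
`CKNTheoremB.lean` proves Theorem B from Proposition 2 (ns.S12, `ckn_epsilon_regularity`) at the
unit viscosity in which both are printed; as the docstring of ns.S11 records ("CKN normalise
`ν = 1`; the general case is the rescaling `u(t, x) ↦ ν⁻¹…`, under which `𝒫¹`-null sets are
preserved"), the general case is a change of variables, carried out here:

* `IsCKNForceOn.stRescale` — the CKN force class `f ∈ L^q(Q)`, `q > 5/2`, `div f = 0`
  (`IsCKNForceOn`) is transported by the space–time rescalings `Φ(s, y) = (t₀ + βs, x₀ + γy)` of
  `SpaceTimeRescaling.lean` (`L^q` class: the accepted `MemLp.smul_uncurry_stPull`; the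
  distributional condition `∫∫ ⟪f, ∇φ⟫ = 0`: chain rule `∇(φ ∘ Φ⁻¹)` and change of variables,
  as in the accepted `IsDistributionalNSSolutionOn.stRescale`);
* `isParabolicNull_image_stAffine` — `𝒫^s`-null sets stay `𝒫^s`-null under the time dilations
  `Φ(s, y) = (t₀ + βs, x₀ + y)`: `Φ(Q*_r(z)) ⊆ Q*_{cr}(Φ z)` with `c = max(1, √β)`, so an admissible
  cover of cost `Σ rᵢ^s` is mapped to one of cost `c^s Σ rᵢ^s`;
* `isRegularPoint_of_viscosity_rescale` — if `w(s, y) = ν⁻¹ u(s/ν, y)` is essentially bounded on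
  `Q*_r(νt, x)` then `u` is essentially bounded on `(t - r²/ν, t + r²/ν) × B_r(x) ⊇ Q*_ρ(t, x)`,
  `ρ = min(r, r/√ν)`, so regular points of `w` over `(νt, x)` give regular points of `u` at
  `(t, x)`; hence the singular set of `u` lies in the `Φ`-image of that of `w`;
* `ckn_partial_regularity_of_epsilon_regularity : ckn_epsilon_regularity → ckn_partial_regularity`
  — **ns.S11 from ns.S12**: for `(u, p)` suitable with viscosity `ν` and CKN force `f` on `Q`,
  the accepted covariance `IsSuitableWeakSolutionOn.stRescale` with `α = β = ν⁻¹`, `γ = 1` makes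
  `w = ν⁻¹ u ∘ Φ`, `Φ(s, y) = (s/ν, y)`, a suitable weak solution with viscosity `1` and CKN force
  `ν⁻² f ∘ Φ` on `Φ⁻¹(Q)`; its singular set is `𝒫¹`-null by `CKNTheoremB.lean`, and so is its
  `Φ`-image, which contains the singular set of `u`.

After this file the barrier fact `SingularSetDimensionBound = ckn_partial_regularity ∧
scheffer_singular_times` is reduced to `ckn_epsilon_regularity ∧ scheffer_singular_times`
(`Literature/Barriers/NavierStokesRegularity/SingularSetDimensionBoundProofs.lean`).

## References

* L. Caffarelli, R. Kohn, L. Nirenberg, *Partial regularity of suitable weak solutions of the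
  Navier–Stokes equations*, Comm. Pure Appl. Math. 35 (1982), 771–831, §1 (normalisation
  `ν = 1`), §2 (scaling), §6 (Theorem B). [CaffarelliKohnNirenberg1982]
* J. C. Robinson, J. L. Rodrigo, W. Sadowski, *The Three-Dimensional Navier–Stokes Equations*,
  CUP (2016), Thm. 16.2. [RobinsonRodrigoSadowski2016]
-/

noncomputable section

open MeasureTheory Set Function Filter Topology TopologicalSpace Metric
open scoped NNReal ENNReal InnerProductSpace RealInnerProductSpace

namespace Literature.Analysis.FluidPDE

/-! ### Transport of the CKN force class -/

section Force

/-- **The CKN force class is covariant under space–time rescaling**: if `f ∈ L^q(Q)` for some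
`q > 5/2` with `div f = 0` in `𝒟'(Q)` (`IsCKNForceOn Q f`), then for `β, γ > 0` and any `a`,
`a • f ∘ Φ` is a CKN force on `Φ⁻¹(Q)`, `Φ(s, y) = (t₀ + βs, x₀ + γy)`: the `L^q` class is
transported by the change of variables (`MemLp.smul_uncurry_stPull`) and, for a test function `φ`
on `Φ⁻¹(Q)`, `∫∫ ⟪a f ∘ Φ, ∇φ⟫ = aγ (βγ³)⁻¹ ∫∫ ⟪f, ∇(φ ∘ Φ⁻¹)⟫ = 0` (Caffarelli–Kohn–Nirenberg
1982, §2: the class (2.1)–(2.5) is scale covariant). [cite: CaffarelliKohnNirenberg1982, §2] -/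
theorem IsCKNForceOn.stRescale {Q : Opens (ℝ × EuclideanSpace ℝ (Fin 3))}
    {f : ℝ → EuclideanSpace ℝ (Fin 3) → EuclideanSpace ℝ (Fin 3)} (hf : IsCKNForceOn Q f)
    {β γ : ℝ} (hβ : 0 < β) (hγ : 0 < γ) (t₀ : ℝ) (x₀ : EuclideanSpace ℝ (Fin 3)) (a : ℝ) :
    IsCKNForceOn (stPreimage β γ t₀ x₀ Q) (a • stPull β γ t₀ x₀ f) := by
  obtain ⟨⟨q, hq, hfq⟩, hdiv⟩ := hf
  refine ⟨⟨q, hq, hfq.smul_uncurry_stPull hβ hγ t₀ x₀ a⟩, fun φ hφ => ?_⟩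
  set φ' := stPull β⁻¹ γ⁻¹ (-(β⁻¹ * t₀)) (-(γ⁻¹ • x₀)) φ with hφ'
  have hφ'Q : IsSpaceTimeTestOn Q φ' := hφ.stPull_symm hβ.ne' hγ.ne'
  have hrepr : φ = stPull β γ t₀ x₀ φ' := (stPull_stPull_symm hβ.ne' hγ.ne' t₀ x₀ φ).symm
  set F : ℝ → EuclideanSpace ℝ (Fin 3) → ℝ := fun t x => ⟪f t x, gradient (φ' t) x⟫ with hF
  have hzero : ∫ t, ∫ x, F t x = 0 := hdiv φ' hφ'Q
  have key : ∀ (s : ℝ) (y : EuclideanSpace ℝ (Fin 3)),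
      ⟪(a • stPull β γ t₀ x₀ f) s y, gradient (φ s) y⟫ = (a * γ) * F (t₀ + β * s) (x₀ + γ • y) := by
    intro s y
    conv_lhs => rw [hrepr]
    rw [gradient_stPull, smul_stPull_apply, real_inner_smul_left, real_inner_smul_right, hF]
    dsimp only
    ring
  simp_rw [key, integral_const_mul]
  rw [integral_integral_comp_stAffine hβ hγ t₀ x₀ F, hzero, smul_zero, mul_zero]

end Force

/-! ### Time dilations preserve `𝒫^s`-null sets -/

section Null

variable {X : Type*} [NormedAddCommGroup X] [InnerProductSpace ℝ X]

/-- A time dilation maps cylinders into dilated cylinders: `Φ(Q*_r(z)) ⊆ Q*_{cr}(Φ z)` for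
`Φ(s, y) = (t₀ + βs, x₀ + y)` and `c = max(1, √β)` (time extent `βr² ≤ c²r²`, space extent
`r ≤ cr`). [folklore] -/
theorem image_stAffine_parabolicCylinderCentered_subset {β : ℝ} (hβ : 0 < β) (t₀ : ℝ) (x₀ : X)
    (r : ℝ) (z : ℝ × X) :
    stAffine β 1 t₀ x₀ '' parabolicCylinderCentered r z ⊆
      parabolicCylinderCentered (max 1 (Real.sqrt β) * r) (stAffine β 1 t₀ x₀ z) := by
  rintro _ ⟨w, hw, rfl⟩
  rw [mem_parabolicCylinderCentered] at hw ⊢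
  obtain ⟨⟨h1, h2⟩, h3⟩ := hw
  have hr : 0 < r := dist_nonneg.trans_lt h3
  set c := max 1 (Real.sqrt β) with hc
  have hc1 : 1 ≤ c := le_max_left _ _
  have hcβ : β ≤ c ^ 2 := by
    calc β = Real.sqrt β ^ 2 := (Real.sq_sqrt hβ.le).symm
      _ ≤ c ^ 2 := pow_le_pow_left₀ (Real.sqrt_nonneg _) (le_max_right _ _) 2
  simp only [stAffine_fst, stAffine_snd, one_smul]
  refine ⟨⟨?_, ?_⟩, ?_⟩
  · have : β * (z.1 - r ^ 2) < β * w.1 := mul_lt_mul_of_pos_left h1 hβ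
    nlinarith [mul_le_mul_of_nonneg_right hcβ (sq_nonneg r)]
  · have : β * w.1 < β * (z.1 + r ^ 2) := mul_lt_mul_of_pos_left h2 hβ
    nlinarith [mul_le_mul_of_nonneg_right hcβ (sq_nonneg r)]
  · rw [dist_add_left]
    calc dist w.2 z.2 < r := h3
      _ = 1 * r := (one_mul r).symm
      _ ≤ c * r := mul_le_mul_of_nonneg_right hc1 hr.le

/-- **Time dilations preserve `𝒫^s`-null sets**: if `𝒫^s(X) = 0` then
`𝒫^s(Φ(X)) = 0` for `Φ(s, y) = (t₀ + βs, x₀ + y)`, `β > 0` — an admissible cover `{Q*_{rᵢ}(zᵢ)}`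
of `X` of cost `Σ rᵢ^s` is mapped into the admissible cover `{Q*_{crᵢ}(Φ zᵢ)}` of `Φ(X)` of cost
`c^s Σ rᵢ^s`, `c = max(1, √β)` (Caffarelli–Kohn–Nirenberg 1982, §1: the normalisation `ν = 1`
does not affect Theorem B). [cite: CaffarelliKohnNirenberg1982, §1 and (2.6)] -/
theorem isParabolicNull_image_stAffine {s : ℝ} {β : ℝ} (hβ : 0 < β) (t₀ : ℝ)
    (x₀ : X) {Y : Set (ℝ × X)} (hY : IsParabolicNull s Y) :
    IsParabolicNull s (stAffine β 1 t₀ x₀ '' Y) := by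
  set c := max 1 (Real.sqrt β) with hc
  have hc0 : 0 < c := lt_of_lt_of_le one_pos (le_max_left _ _)
  have hcs : ENNReal.ofReal (c ^ s) ≠ 0 := (ENNReal.ofReal_pos.2 (Real.rpow_pos_of_pos hc0 s)).ne'
  change parabolicHausdorff s _ = 0
  refine le_antisymm (iSup₂_le fun δ hδ => ?_) zero_le
  refine ENNReal.le_of_forall_pos_le_add fun η hη _ => ?_
  rw [zero_add]
  -- a cheap fine cover of `Y`
  set η' : ℝ≥0∞ := (ENNReal.ofReal (c ^ s))⁻¹ * η with hη'
  have hη'0 : η' ≠ 0 :=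
    mul_ne_zero (ENNReal.inv_ne_zero.2 ENNReal.ofReal_ne_top) (ENNReal.coe_ne_zero.2 hη.ne')
  have hlt : parabolicHausdorffContent s (δ / c) Y < η' := by
    calc parabolicHausdorffContent s (δ / c) Y ≤ parabolicHausdorff s Y :=
          le_iSup₂ (f := fun (δ : ℝ) (_ : 0 < δ) => parabolicHausdorffContent s δ Y) (δ / c)
            (div_pos hδ hc0)
      _ = 0 := hY
      _ < η' := pos_iff_ne_zero.2 hη'0
  obtain ⟨z, r, hr, hYc, hsum⟩ := exists_cover_of_parabolicHausdorffContent_lt hlt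
  -- its image is an admissible cover of `Φ '' Y`
  calc parabolicHausdorffContent s δ (stAffine β 1 t₀ x₀ '' Y)
      ≤ ∑' j, ENNReal.ofReal ((c * r j) ^ s) := by
        refine iInf_le_of_le (fun j => stAffine β 1 t₀ x₀ (z j)) <|
          iInf_le_of_le (fun j => c * r j) <| iInf_le_of_le (fun j => ⟨?_, ?_⟩) <|
          iInf_le_of_le ?_ le_rfl
        · exact mul_nonneg hc0.le (hr j).1
        · calc c * r j < c * (δ / c) := mul_lt_mul_of_pos_left (hr j).2 hc0
            _ = δ := mul_div_cancel₀ δ hc0.ne'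
        · calc stAffine β 1 t₀ x₀ '' Y
              ⊆ stAffine β 1 t₀ x₀ '' ⋃ j, parabolicCylinderCentered (r j) (z j) :=
                image_mono hYc
            _ ⊆ ⋃ j, parabolicCylinderCentered (c * r j) (stAffine β 1 t₀ x₀ (z j)) := by
                rw [image_iUnion]
                exact iUnion_mono fun j =>
                  image_stAffine_parabolicCylinderCentered_subset hβ t₀ x₀ (r j) (z j)
    _ = ENNReal.ofReal (c ^ s) * ∑' j, ENNReal.ofReal (r j ^ s) := by
        rw [← ENNReal.tsum_mul_left]
        refine tsum_congr fun j => ?_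
        rw [Real.mul_rpow hc0.le (hr j).1, ENNReal.ofReal_mul (Real.rpow_nonneg hc0.le s)]
    _ ≤ ENNReal.ofReal (c ^ s) * η' := mul_le_mul' le_rfl hsum.le
    _ = η := by rw [hη', ← mul_assoc, ENNReal.mul_inv_cancel hcs ENNReal.ofReal_ne_top, one_mul]

end Null

/-! ### Regular points under the viscosity normalisation -/

section Regular

/-- **Regular points under the viscosity normalisation.** Let `ν > 0` and
`w(s, y) = ν⁻¹ u(s/ν, y)` (`w = ν⁻¹ • stPull ν⁻¹ 1 0 0 u`). If `(νt, x)` is a regular point of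
`w` then `(t, x)` is a regular point of `u`: an essential bound for `w` on `Q*_r(νt, x)`, which is
the preimage of `T = (t - r²/ν, t + r²/ν) × B_r(x)` under `(s, y) ↦ (s/ν, y)`, is transported to
an essential bound for `u` on `T ⊇ Q*_ρ(t, x)`, `ρ = min(r, r/√ν)` (Caffarelli–Kohn–Nirenberg
1982, §6: regularity = essential boundedness near the point; §1: normalisation `ν = 1`).
[cite: CaffarelliKohnNirenberg1982, §1 and §6] -/
theorem isRegularPoint_of_viscosity_rescale {ν : ℝ} (hν : 0 < ν)
    {u : ℝ → EuclideanSpace ℝ (Fin 3) → EuclideanSpace ℝ (Fin 3)} {t : ℝ}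
    {x : EuclideanSpace ℝ (Fin 3)}
    (h : IsRegularPoint (ν⁻¹ • stPull ν⁻¹ 1 0 0 u) (ν * t, x)) : IsRegularPoint u (t, x) := by
  obtain ⟨r, hr, hfin⟩ := h
  set w : ℝ → EuclideanSpace ℝ (Fin 3) → EuclideanSpace ℝ (Fin 3) :=
    ν⁻¹ • stPull ν⁻¹ 1 0 0 u with hw
  set μ' : Measure (ℝ × EuclideanSpace ℝ (Fin 3)) :=
    volume.restrict (parabolicCylinderCentered r (ν * t, x)) with hμ'
  -- an a.e. bound for `w` on the cylinder
  have hM : eLpNormEssSup (uncurry w) μ' < ∞ := by rwa [← eLpNorm_exponent_top]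
  set C : ℝ := (eLpNormEssSup (uncurry w) μ').toReal with hC
  have hbw : ∀ᵐ q ∂μ', ‖uncurry w q‖ ≤ C := by
    filter_upwards [ae_le_eLpNormEssSup (f := uncurry w) (μ := μ')] with q hq
    rw [← ENNReal.ofReal_le_iff_le_toReal hM.ne, ofReal_norm]
    exact hq
  -- the box `T = Φ(Q*_r(νt, x))`
  set T : Set (ℝ × EuclideanSpace ℝ (Fin 3)) :=
    Ioo (t - r ^ 2 / ν) (t + r ^ 2 / ν) ×ˢ ball x r with hT
  have hpre : stAffine ν⁻¹ 1 0 0 ⁻¹' T ⊆ parabolicCylinderCentered r (ν * t, x) := by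
    rintro ⟨s, y⟩ hq
    simp only [mem_preimage, stAffine_apply, hT, mem_prod, mem_Ioo, mem_ball, one_smul,
      zero_add] at hq
    obtain ⟨⟨h1, h2⟩, h3⟩ := hq
    rw [inv_mul_eq_div, lt_div_iff₀ hν] at h1
    rw [inv_mul_eq_div, div_lt_iff₀ hν] at h2
    have e1 : (t - r ^ 2 / ν) * ν = ν * t - r ^ 2 := by field_simp
    have e2 : (t + r ^ 2 / ν) * ν = ν * t + r ^ 2 := by field_simp
    rw [mem_parabolicCylinderCentered]
    exact ⟨⟨by linarith, by linarith⟩, h3⟩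
  -- transport the bound to `u` on `T`
  have hbu : ∀ᵐ q ∂(volume.restrict T), ‖u q.1 q.2‖ ≤ ν * C := by
    have h1 : ∀ᵐ q ∂(volume.restrict (stAffine ν⁻¹ 1 0 0 ⁻¹' T)), ‖uncurry w q‖ ≤ C :=
      ae_restrict_of_ae_restrict_of_subset hpre hbw
    refine ae_restrict_of_ae_restrict_preimage_stAffine (inv_pos.2 hν) one_pos 0 0
      (P := fun q : ℝ × EuclideanSpace ℝ (Fin 3) => ‖u q.1 q.2‖ ≤ ν * C) ?_
    filter_upwards [h1] with q hq
    have e : uncurry w q = ν⁻¹ • u (stAffine ν⁻¹ 1 0 0 q).1 (stAffine ν⁻¹ 1 0 0 q).2 := rfl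
    rw [e, norm_smul, Real.norm_eq_abs, abs_of_pos (inv_pos.2 hν)] at hq
    exact (inv_mul_le_iff₀ hν).1 hq
  -- a centred cylinder about `(t, x)` inside `T`
  set ρ : ℝ := min r (r / Real.sqrt ν) with hρ
  have hsν : 0 < Real.sqrt ν := Real.sqrt_pos.2 hν
  have hρ0 : 0 < ρ := lt_min hr (div_pos hr hsν)
  have hρr : ρ ≤ r := min_le_left _ _
  have hρ2 : ρ ^ 2 ≤ r ^ 2 / ν := by
    calc ρ ^ 2 ≤ (r / Real.sqrt ν) ^ 2 :=
          pow_le_pow_left₀ hρ0.le (min_le_right _ _) 2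
      _ = r ^ 2 / ν := by rw [div_pow, Real.sq_sqrt hν.le]
  have hsub : parabolicCylinderCentered ρ ((t, x) : ℝ × EuclideanSpace ℝ (Fin 3)) ⊆ T := by
    intro q hq
    rw [mem_parabolicCylinderCentered] at hq
    obtain ⟨⟨h1, h2⟩, h3⟩ := hq
    simp only [hT, mem_prod, mem_Ioo, mem_ball]
    exact ⟨⟨by linarith, by linarith⟩, h3.trans_le hρr⟩
  exact isRegularPoint_of_ae_bound_superset hρ0 hsub hbu

end Regular

/-! ### Theorem B for every viscosity -/

section Assembly

/-- **ns.S11 from ns.S12: Caffarelli–Kohn–Nirenberg's Theorem B for every viscosity `ν > 0`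
follows from their Proposition 2** (`ckn_epsilon_regularity → ckn_partial_regularity`).
Given a suitable weak solution `(u, p)` with viscosity `ν` and CKN force `f` on `Q`, the
rescaled `w = ν⁻¹ u ∘ Φ`, `q = ν⁻² p ∘ Φ`, `Φ(s, y) = (s/ν, y)`, is a suitable weak solution with
viscosity `1` and CKN force `ν⁻² f ∘ Φ` on `Φ⁻¹(Q)` (accepted `IsSuitableWeakSolutionOn.stRescale`
with `α = β = ν⁻¹`, `γ = 1`; `IsCKNForceOn.stRescale`), so `𝒫¹(S(w)) = 0` by Theorem B at unit
viscosity (`isParabolicNull_singularSet_of_epsilon_regularity`, `CKNTheoremB.lean`); the singular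
set of `u` lies in `Φ(S(w))` (`isRegularPoint_of_viscosity_rescale`), which is `𝒫¹`-null
(`isParabolicNull_image_stAffine`). This is the normalisation "`ν = 1`" of
Caffarelli–Kohn–Nirenberg 1982, §1, applied to Theorem B.
[cite: CaffarelliKohnNirenberg1982, Theorem B and §1] -/
theorem ckn_partial_regularity_of_epsilon_regularity (hε : ckn_epsilon_regularity) :
    ckn_partial_regularity := by
  intro Q ν hν f u p h hf
  have hβ : 0 < ν⁻¹ := inv_pos.2 hν
  have hw := h.stRescale (α := ν⁻¹) (β := ν⁻¹) (γ := 1) hβ one_pos (mul_one _).symm 0 0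
  have h1 : ν⁻¹ * ν / 1 = 1 := by rw [div_one, inv_mul_cancel₀ hν.ne']
  rw [h1] at hw
  have hf' := hf.stRescale hβ one_pos 0 0 (ν⁻¹ ^ 2 * 1)
  have hnull := isParabolicNull_singularSet_of_epsilon_regularity hε hw hf'
  refine (isParabolicNull_image_stAffine hβ 0 0 hnull).mono ?_
  intro z hz
  have hΦz : stAffine ν⁻¹ 1 0 0 (ν * z.1, z.2) = z := by
    ext
    · simp [inv_mul_cancel_left₀ hν.ne']
    · simp
  refine ⟨(ν * z.1, z.2), ⟨?_, fun hreg => hz.2 ?_⟩, hΦz⟩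
  · show stAffine ν⁻¹ 1 0 0 (ν * z.1, z.2) ∈ (Q : Set (ℝ × EuclideanSpace ℝ (Fin 3)))
    rw [hΦz]
    exact hz.1
  · exact isRegularPoint_of_viscosity_rescale hν hreg

end Assembly

end Literature.Analysis.FluidPDE
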